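import Mathlib
import Literature.LinearAlgebra.Matrix.BipartiteForestCofactor
import Literature.LinearAlgebra.Matrix.AdjugateRankOne
import Literature.NumberTheory.EllipticCurves.Smith2016.CongruentNumberGenusDeterminantBlocks
import Literature.NumberTheory.EllipticCurves.Smith2016.CongruentNumberRedeiCofactor

/-!
# Monsky's odd matrix as a POINTED forest sum (towards Smith 2016, Thm. 2.2 row 3, every `k`)

A. Smith, *The congruent numbers have positive natural density*, arXiv:1603.08479, §2.2
[Smith2016CongruentDensity]: row 3 of Thm. 2.2 is read off the bordered determinant
`|[[A + Aᵀ, Aᵀ, u],[A, D_z, 0],[uᵀ, 0, 0]]| = Σ_S det O(A, z, u)[S] · det M₁(A, z)[S′]` with `u = y`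
("the `d` corresponding to `S` is equal to `3` mod `8` … this determinant equals `g(d)` per Table 1").
Here the same structure is derived for MONSKY's odd matrix `M = [[A + D₂, D₂],[D₂, A + D₋₂]]`
(Heath-Brown 1994, appendix [HeathBrown1994SelmerCongruentII]) directly, for every number of primes:

* `det_monskyMatrixOdd_eq_det_bigN_add_vecMulVec` — `det M = det (N + u vᵀ)` where
  `N = [[D_z, (A + D_z)ᵀ],[A + D_z, D_z]]` is the doubled forest matrix of `A` (`bigN`, marks = roots =
  extra roots = `z`, `zᵢ = (2/pᵢ)₊`) and `u = (t; 0)`, `v = (0; t)`, `tᵢ = (−1/pᵢ)₊` (swap the block rows;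
  reciprocity `A + Aᵀ = D₋₁ + t tᵀ`, Monsky's (31));
* for `∏ pᵢ ≡ 3 (mod 4)` (`Σ tᵢ = 1`) the rows AND columns of `N` sum to zero, so all cofactors of `N`
  agree and `det N = 0` (`Literature/LinearAlgebra/Matrix/AdjugateRankOne`); hence
  `det M = (Σ u)(Σ v) · adj(N)_{aa} = adj(N)_{aa} = Σ_j t_j · adj(N)_{(inl j),(inl j)}`
  (`det_monskyMatrixOdd_eq_sum_mul_adjugate`) — Smith's bordered determinant, a pointed forest sum by
  `Literature/LinearAlgebra/Matrix/BipartiteForestCofactor`;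
* the block dictionary for the POINTED block (`qwt_legendre_eq_genusWeight`): for every block `B ≠ ∅`,
  `q_z(A^B) = [d_B ≡ 1 (4) ∨ d_B ≡ 3 (8)] · g(d_B)` in `𝔽₂` — Smith's Table 1, rows `n ≡ 1 (4)`
  (`CongruentNumberRedeiDeterminant`) and `n ≡ 3 (4)` (`CongruentNumberRedeiCofactor`: the column sums
  of `A^B` vanish, so `det Q(A, z)[B] = (Σ_B z) ·` cofactor).
The assembly with the genus sum `ℒ₃` is `CongruentNumberGenusDeterminantRowThreeHolds`.
-/

namespace Literature.NumberTheory.EllipticCurves.Smith2016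

open _root_.Matrix Finset Literature.LinearAlgebra.Matrix Literature.Combinatorics.Enumerative
open Literature.NumberTheory.EllipticCurves.HeathBrown1994
open Literature.NumberTheory.EllipticCurves.TianYuanZhang2017
open Literature.NumberTheory.EllipticCurves.HeathBrown1994.Families (legendreMatrix_apply_of_ne legendreMatrix_apply_self)
open Literature.NumberTheory.EllipticCurves.MonskySelmerParity

variable {k : ℕ} (p : Fin k → ℕ)

section MatrixIdentity

/-- The rank-one matrix `(t; 0)(0; t)ᵀ` on `Fin k ⊕ Fin k` is the block matrix `[[0, t tᵀ],[0, 0]]`.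
[cite: HeathBrown1994SelmerCongruentII, Appendix (Monsky), typescript p. 40 L2–L8 (M₁ = M + (0 0; 0 uᵀu))] -/
theorem vecMulVec_sum_elim (t : Fin k → ZMod 2) :
    vecMulVec (Sum.elim t (0 : Fin k → ZMod 2)) (Sum.elim (0 : Fin k → ZMod 2) t) =
      fromBlocks (0 : Matrix (Fin k) (Fin k) (ZMod 2)) (vecMulVec t t) 0 0 := by
  ext (i | i) (j | j) <;> simp [vecMulVec_apply]

/-- Monsky's `A` has zero row sums in the forest-file form `A_ii = Σ_{j ≠ i} A_ij`.
[cite: HeathBrown1994SelmerCongruentII, Appendix (Monsky), typescript p. 39 L13–L26] -/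
theorem legendreMatrix_diag_eq_sum (i : Fin k) :
    legendreMatrix p i i = ∑ j ∈ univ.erase i, legendreMatrix p i j :=
  legendreMatrix_apply_self p i

/-- **Swapping the block rows of Monsky's odd matrix gives the doubled forest matrix plus `[[0, t tᵀ],[0, 0]]`**:
`[[0, I],[I, 0]] · [[A + D₂, D₂],[D₂, A + D₋₂]] = [[D₂, (A + D₂)ᵀ],[A + D₂, D₂]] + (t;0)(0;t)ᵀ`, by
`D₋₂ = D₋₁ + D₂` and the reciprocity law `A + Aᵀ = D₋₁ + t tᵀ` (Monsky's (31)).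
[cite: HeathBrown1994SelmerCongruentII, Appendix (Monsky), typescript p. 39 L27–L41 (the matrix M and (31))] -/
theorem swap_mul_monskyMatrixOdd (hp : ∀ i, (p i).Prime) (hodd : ∀ i, Odd (p i))
    (hinj : Function.Injective p) :
    fromBlocks (0 : Matrix (Fin k) (Fin k) (ZMod 2)) 1 1 0 * monskyMatrixOdd p =
      bigN (fun i j => legendreMatrix p i j) univ (fun i => addLegendreSym 2 (p i))
          (fun i => addLegendreSym 2 (p i)) (fun i => addLegendreSym 2 (p i)) +
        vecMulVec (Sum.elim (fun i => addLegendreSym (-1) (p i)) (0 : Fin k → ZMod 2))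
          (Sum.elim (0 : Fin k → ZMod 2) (fun i => addLegendreSym (-1) (p i))) := by
  have hp2 := ne_two_of_odd p hodd
  rw [monskyMatrixOdd, fromBlocks_multiply, bigN_univ_eq_fromBlocks _ (legendreMatrix_diag_eq_sum p),
    vecMulVec_sum_elim, fromBlocks_add]
  simp only [Matrix.zero_mul, Matrix.one_mul, zero_add, add_zero]
  have hD2 : legendreDiagonal p 2 = diagonal fun i => addLegendreSym 2 (p i) := rfl
  have hAt : (legendreMatrix p)ᵀ = legendreMatrix p + legendreDiagonal p (-1) +
      vecMulVec (fun i => addLegendreSym (-1) (p i)) (fun i => addLegendreSym (-1) (p i)) := by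
    rw [add_assoc, ← legendreMatrix_add_transpose p hp hp2 hinj, ← add_assoc, matrix_add_self, zero_add]
  rw [← hD2]
  congr 1
  rw [transpose_add, legendreDiagonal_transpose, hAt, legendreDiagonal_neg_two p hp hp2]
  have hvv := matrix_add_self (vecMulVec (fun i => addLegendreSym (-1) (p i)) (fun i => addLegendreSym (-1) (p i)))
  calc legendreMatrix p + (legendreDiagonal p (-1) + legendreDiagonal p 2)
      = legendreMatrix p + legendreDiagonal p (-1) + legendreDiagonal p 2 + 0 := by rw [add_zero, add_assoc]
    _ = _ := by rw [← hvv]; abel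

/-- The block-row swap has determinant `1` over `𝔽₂` (it squares to the identity).
[cite: HeathBrown1994SelmerCongruentII, Appendix (Monsky), typescript p. 40 L19–L24 (unimodular block operations)] -/
theorem det_fromBlocks_swap :
    (fromBlocks (0 : Matrix (Fin k) (Fin k) (ZMod 2)) (1 : Matrix (Fin k) (Fin k) (ZMod 2))
      (1 : Matrix (Fin k) (Fin k) (ZMod 2)) (0 : Matrix (Fin k) (Fin k) (ZMod 2))).det = 1 := by
  have hsq : fromBlocks (0 : Matrix (Fin k) (Fin k) (ZMod 2)) (1 : Matrix (Fin k) (Fin k) (ZMod 2))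
      (1 : Matrix (Fin k) (Fin k) (ZMod 2)) (0 : Matrix (Fin k) (Fin k) (ZMod 2)) *
      fromBlocks (0 : Matrix (Fin k) (Fin k) (ZMod 2)) (1 : Matrix (Fin k) (Fin k) (ZMod 2))
      (1 : Matrix (Fin k) (Fin k) (ZMod 2)) (0 : Matrix (Fin k) (Fin k) (ZMod 2)) = 1 := by
    rw [fromBlocks_multiply]; simp
  have h := congrArg det hsq
  rw [det_mul, det_one] at h
  exact (by decide : ∀ x : ZMod 2, x * x = 1 → x = 1) _ h

/-- **`det M = det (N + u vᵀ)`**: the determinant of Monsky's odd matrix is that of the doubled forest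
matrix of `A` (marks, roots, extra roots all `z = ((2/pᵢ)₊)`) perturbed by the rank-one matrix
`(t;0)(0;t)ᵀ`, `t = ((−1/pᵢ)₊)`. [cite: HeathBrown1994SelmerCongruentII, Appendix (Monsky), typescript p. 39 L27 – p. 40 L31] [cite: Smith2016CongruentDensity, §2.2 (the bordered determinant for row 3)] -/
theorem det_monskyMatrixOdd_eq_det_bigN_add_vecMulVec (hp : ∀ i, (p i).Prime)
    (hodd : ∀ i, Odd (p i)) (hinj : Function.Injective p) :
    (monskyMatrixOdd p).det =
      (bigN (fun i j => legendreMatrix p i j) univ (fun i => addLegendreSym 2 (p i))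
          (fun i => addLegendreSym 2 (p i)) (fun i => addLegendreSym 2 (p i)) +
        vecMulVec (Sum.elim (fun i => addLegendreSym (-1) (p i)) (0 : Fin k → ZMod 2))
          (Sum.elim (0 : Fin k → ZMod 2) (fun i => addLegendreSym (-1) (p i)))).det := by
  rw [← swap_mul_monskyMatrixOdd p hp hodd hinj, det_mul, det_fromBlocks_swap, one_mul]

end MatrixIdentity

section ThreeModFour

/-- A tuple with `∏ pᵢ ≡ 3 (mod 4)` is nonempty. [cite: Smith2016CongruentDensity, §2 Thm. 2.2 row 3 (n ≡ 3 (8))] -/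
theorem pos_of_prod_mod_four_eq_three (h4 : (∏ i, p i) % 4 = 3) : 0 < k := by
  rcases Nat.eq_zero_or_pos k with hk | hk
  · subst hk
    rw [Fin.prod_univ_zero] at h4
    norm_num at h4
  · exact hk

/-- **For `∏ pᵢ ≡ 3 (mod 4)` the rows of the doubled forest matrix `N` sum to zero**:
top block `z + 1ᵀ(A + D_z) = z + 1ᵀA + z = 0` (the columns of `A` sum to zero, Monsky's (31) with
`Σ tᵢ = 1`), bottom block `(A + D_z)·1 + z = 0`. [cite: HeathBrown1994SelmerCongruentII, Appendix (Monsky), typescript p. 39 L49 – p. 40 L1] -/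
theorem bigN_legendre_mulVec_one (hp : ∀ i, (p i).Prime) (hodd : ∀ i, Odd (p i))
    (hinj : Function.Injective p) (h4 : (∏ i, p i) % 4 = 3) :
    bigN (fun i j => legendreMatrix p i j) univ (fun i => addLegendreSym 2 (p i))
        (fun i => addLegendreSym 2 (p i)) (fun i => addLegendreSym 2 (p i)) *ᵥ
      (fun _ => (1 : ZMod 2)) = 0 := by
  have hvv : ∀ v : Fin k → ZMod 2, v + v = 0 := fun v => by
    funext i; exact CharTwo.add_self_eq_zero (v i)
  have hD2 : (diagonal fun i => addLegendreSym 2 (p i)) = legendreDiagonal p 2 := rfl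
  have h1 : (fun _ : Fin k ⊕ Fin k => (1 : ZMod 2)) =
      Sum.elim (1 : Fin k → ZMod 2) (1 : Fin k → ZMod 2) := by
    ext (i | i) <;> rfl
  rw [bigN_univ_eq_fromBlocks _ (legendreMatrix_diag_eq_sum p), h1, fromBlocks_mulVec, hD2]
  have hl : Sum.elim (1 : Fin k → ZMod 2) (1 : Fin k → ZMod 2) ∘ Sum.inl = (1 : Fin k → ZMod 2) := rfl
  have hr : Sum.elim (1 : Fin k → ZMod 2) (1 : Fin k → ZMod 2) ∘ Sum.inr = (1 : Fin k → ZMod 2) := rfl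
  rw [hl, hr, mulVec_transpose, vecMul_add, add_mulVec,
    one_vecMul_legendreMatrix_of_three_mod_four p hp hodd hinj h4, zero_add, legendreMatrix_mulVec_one,
    zero_add, legendreDiagonal_mulVec_one, one_vecMul_legendreDiagonal, hvv]
  ext (i | i) <;> rfl

/-- … and so do its columns (`N` is symmetric). [cite: HeathBrown1994SelmerCongruentII, Appendix (Monsky), typescript p. 39 L49 – p. 40 L1] -/
theorem one_vecMul_bigN_legendre (hp : ∀ i, (p i).Prime) (hodd : ∀ i, Odd (p i))
    (hinj : Function.Injective p) (h4 : (∏ i, p i) % 4 = 3) :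
    (fun _ => (1 : ZMod 2)) ᵥ*
      bigN (fun i j => legendreMatrix p i j) univ (fun i => addLegendreSym 2 (p i))
        (fun i => addLegendreSym 2 (p i)) (fun i => addLegendreSym 2 (p i)) = 0 := by
  rw [← mulVec_transpose, bigN_transpose, bigN_legendre_mulVec_one p hp hodd hinj h4]

/-- `Σ tᵢ = 1` for `∏ pᵢ ≡ 3 (mod 4)`. [cite: HeathBrown1994SelmerCongruentII, Appendix (Monsky), typescript p. 39 L36–L37] -/
theorem sum_addLegendreSym_neg_one_eq_one (hp : ∀ i, (p i).Prime) (hodd : ∀ i, Odd (p i))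
    (h4 : (∏ i, p i) % 4 = 3) : ∑ i, addLegendreSym (-1) (p i) = 1 := by
  rw [sum_addLegendreSym_neg_one_eq p hp (ne_two_of_odd p hodd), if_neg (by omega)]

/-- **`det M = adj(N)_{aa}` for every index `a`** when `∏ pᵢ ≡ 3 (mod 4)`: `det (N + u vᵀ) =
(Σ u)(Σ v) adj(N)_{aa}` with `Σ u = Σ v = Σ tᵢ = 1`.
[cite: Smith2016CongruentDensity, §2 proof of Thm. 1.2 (chunk p0005 L65–L75: M₃[[2r],[2r]] has rank two less than M₃) and §2.2] -/
theorem det_monskyMatrixOdd_eq_adjugate (hp : ∀ i, (p i).Prime) (hodd : ∀ i, Odd (p i))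
    (hinj : Function.Injective p) (h4 : (∏ i, p i) % 4 = 3) (a₀ : Fin k ⊕ Fin k) :
    (monskyMatrixOdd p).det =
      (bigN (fun i j => legendreMatrix p i j) univ (fun i => addLegendreSym 2 (p i))
        (fun i => addLegendreSym 2 (p i)) (fun i => addLegendreSym 2 (p i))).adjugate a₀ a₀ := by
  haveI : Nonempty (Fin k ⊕ Fin k) := ⟨a₀⟩
  have ht := sum_addLegendreSym_neg_one_eq_one p hp hodd h4
  rw [det_monskyMatrixOdd_eq_det_bigN_add_vecMulVec p hp hodd hinj,
    det_add_vecMulVec_of_mulVec_one _ (bigN_legendre_mulVec_one p hp hodd hinj h4)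
      (one_vecMul_bigN_legendre p hp hodd hinj h4) _ _ a₀,
    Fintype.sum_sum_type, Fintype.sum_sum_type]
  simp only [Sum.elim_inl, Sum.elim_inr, Pi.zero_apply, sum_const_zero, add_zero, zero_add]
  rw [ht, one_mul, one_mul]

/-- **Monsky's determinant as Smith's bordered determinant**: for `∏ pᵢ ≡ 3 (mod 4)`,
`det M = Σ_j t_j · adj(N)_{(inl j),(inl j)}` (all cofactors of `N` agree and `Σ t_j = 1`) — the
expansion of `|[[N, u],[uᵀ, 0]]|` with `u = (t; 0)`.
[cite: Smith2016CongruentDensity, §2.2 (chunk p0008 L30–L50: the bordered determinant with u = y)] -/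
theorem det_monskyMatrixOdd_eq_sum_mul_adjugate (hp : ∀ i, (p i).Prime) (hodd : ∀ i, Odd (p i))
    (hinj : Function.Injective p) (h4 : (∏ i, p i) % 4 = 3) :
    (monskyMatrixOdd p).det =
      ∑ j, addLegendreSym (-1) (p j) *
        (bigN (fun i j => legendreMatrix p i j) univ (fun i => addLegendreSym 2 (p i))
          (fun i => addLegendreSym 2 (p i)) (fun i => addLegendreSym 2 (p i))).adjugate
            (Sum.inl j) (Sum.inl j) := by
  have hk := pos_of_prod_mod_four_eq_three p h4
  haveI : Nonempty (Fin k ⊕ Fin k) := ⟨Sum.inl ⟨0, hk⟩⟩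
  set N := bigN (fun i j => legendreMatrix p i j) univ (fun i => addLegendreSym 2 (p i))
    (fun i => addLegendreSym 2 (p i)) (fun i => addLegendreSym 2 (p i)) with hN
  have hall : ∀ j, N.adjugate (Sum.inl j) (Sum.inl j) = N.adjugate (Sum.inl ⟨0, hk⟩) (Sum.inl ⟨0, hk⟩) :=
    fun j => adjugate_apply_eq_adjugate_apply N (bigN_legendre_mulVec_one p hp hodd hinj h4)
      (one_vecMul_bigN_legendre p hp hodd hinj h4) _ _ _ _
  have hsum : ∑ j, addLegendreSym (-1) (p j) * N.adjugate (Sum.inl j) (Sum.inl j) =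
      (∑ j, addLegendreSym (-1) (p j)) * N.adjugate (Sum.inl ⟨0, hk⟩) (Sum.inl ⟨0, hk⟩) := by
    rw [sum_mul]
    exact sum_congr rfl fun j _ => by rw [hall j]
  rw [hsum, sum_addLegendreSym_neg_one_eq_one p hp hodd h4, one_mul]
  exact det_monskyMatrixOdd_eq_adjugate p hp hodd hinj h4 _

end ThreeModFour

section PointedBlock

/-- **The block dictionary for the pointed block** (Smith's Table 1, both odd rows): for every nonempty
block `B` of a tuple of distinct odd primes, with `d_B = ∏_{i∈B} pᵢ` and `g(d) = #2Cl(ℚ(√−d))`,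
`q_z(A^B) = det Q(A, z)[B] = [d_B ≡ 1 (4)] · g(d_B) + [d_B ≡ 3 (8)] · g(d_B)` in `𝔽₂`
(`d_B ≡ 1 (4)`: Rédei–Reichardt, `det (A | z) = g`; `d_B ≡ 3 (4)`: the columns of `A^B` sum to zero, so
`det Q = (Σ_B z) ·` cofactor `= [d_B ≡ 3 (8)] · g(d_B)`).
[cite: Smith2016CongruentDensity, §2 Table 1 (rows n ≡ 1, 3 (4)) and §2.2 (chunk p0008 L42–L50)] -/
theorem qwt_legendre_eq_genusWeight (hp : ∀ i, (p i).Prime) (hodd : ∀ i, Odd (p i))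
    (hinj : Function.Injective p) {B : Finset (Fin k)} (hB : B.Nonempty) :
    qwt (fun i j => legendreMatrix p i j) (fun i => addLegendreSym 2 (p i)) B =
      if (∏ i ∈ B, p i) % 4 = 1 then ((genusClassNumber (GenusField (∏ i ∈ B, p i)) : ℕ) : ZMod 2)
      else if (∏ i ∈ B, p i) % 8 = 3 then
        ((genusClassNumber (GenusField (∏ i ∈ B, p i)) : ℕ) : ZMod 2) else 0 := by
  obtain ⟨c, hc⟩ := hB
  set q : Fin B.card → ℕ := fun x => p ((B.equivFin.symm x : {i // i ∈ B}) : Fin k) with hq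
  have hqp : ∀ x, (q x).Prime := fun x => hp _
  have hqo : ∀ x, Odd (q x) := fun x => hodd _
  have hq2 : ∀ x, q x ≠ 2 := ne_two_of_odd q hqo
  have hqinj : Function.Injective q := fun x y h =>
    B.equivFin.symm.injective (Subtype.ext (hinj h))
  have hprod : ∏ x, q x = ∏ i ∈ B, p i := prod_subtuple p B
  have hdodd : Odd (∏ i ∈ B, p i) := hprod ▸ MonskySelmerParity.odd_prod q hqp hq2
  have hd2 : (∏ i ∈ B, p i) % 2 = 1 := Nat.odd_iff.mp hdodd
  -- the column form of the block weight, re-indexed to the sub-tuple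
  have hqwt : qwt (fun i j => legendreMatrix p i j) (fun i => addLegendreSym 2 (p i)) B =
      ((legendreMatrix q).updateCol (B.equivFin ⟨c, hc⟩) fun x => addLegendreSym 2 (q x)).det := by
    rw [qwt_eq_det_updateCol _ _ hc, det_updateCol_lap_eq_subtuple p B hc _ (fun i hi => if_neg hi)]
    congr 2
    funext x
    rw [if_pos (B.equivFin.symm x).2]
  by_cases h1 : (∏ i ∈ B, p i) % 4 = 1
  · -- `d ≡ 1 (4)`: Rédei–Reichardt (Table 1, row n ≡ 1 (4))
    rw [if_pos h1, hqwt]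
    symm
    refine natCast_eq_of_odd_iff ?_
    have h4 : (∏ x, q x) % 4 = 1 := by rw [hprod]; exact h1
    have h := odd_genusClassNumber_genusField_iff_det_updateCol q hqp hqo hqinj h4 (B.equivFin ⟨c, hc⟩)
    rw [hprod] at h
    exact h
  · -- `d ≡ 3 (4)`: the columns of `A^B` vanish; `det Q = (Σ z) · adj`
    have h3 : (∏ i ∈ B, p i) % 4 = 3 := by omega
    have h3q : (∏ x, q x) % 4 = 3 := by rw [hprod]; exact h3
    haveI : Nonempty (Fin B.card) := ⟨B.equivFin ⟨c, hc⟩⟩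
    rw [if_neg h1, hqwt, det_updateCol_eq_sum_mul_adjugate (legendreMatrix q)
      (one_vecMul_legendreMatrix_of_three_mod_four q hqp hqo hqinj h3q) _ _,
      sum_subtuple p B (fun n => addLegendreSym 2 n),
      HeathBrown1994.Families.sum_addLegendreSym_two_eq B p fun i _ => Nat.odd_iff.mp (hodd i)]
    have hadj := odd_genusClassNumber_genusField_iff_adjugate q hqp hqo hqinj h3q (B.equivFin ⟨c, hc⟩)
    rw [hprod] at hadj
    by_cases h83 : (∏ i ∈ B, p i) % 8 = 3
    · rw [if_pos (Or.inl h83), if_pos h83, one_mul]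
      symm
      exact natCast_eq_of_odd_iff hadj
    · rw [if_neg (by omega), if_neg h83, zero_mul]

/-- The pointed block weight `(Σ_B t) · q_z(A^B)` is Smith's row-3 weight `[d_B ≡ 3 (8)] · g(d_B)`
(`Σ_B tᵢ = [d_B ≡ 3 (4)]`). [cite: Smith2016CongruentDensity, §2.2 (chunk p0008 L42–L50: "we need Σ_{i∈S} yᵢ ≠ 0 … Σ_{i∈S} zᵢ ≠ 0 … this determinant equals g(d)")] -/
theorem pointedWeight_legendre_eq_genusWeight (hp : ∀ i, (p i).Prime) (hodd : ∀ i, Odd (p i))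
    (hinj : Function.Injective p) {B : Finset (Fin k)} (hB : B.Nonempty) :
    (∑ i ∈ B, addLegendreSym (-1) (p i)) *
        qwt (fun i j => legendreMatrix p i j) (fun i => addLegendreSym 2 (p i)) B =
      if (∏ i ∈ B, p i) % 8 = 3 then
        ((genusClassNumber (GenusField (∏ i ∈ B, p i)) : ℕ) : ZMod 2) else 0 := by
  set q : Fin B.card → ℕ := fun x => p ((B.equivFin.symm x : {i // i ∈ B}) : Fin k) with hq
  have hqp : ∀ x, (q x).Prime := fun x => hp _
  have hqo : ∀ x, Odd (q x) := fun x => hodd _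
  have hq2 : ∀ x, q x ≠ 2 := ne_two_of_odd q hqo
  have hprod : ∏ x, q x = ∏ i ∈ B, p i := prod_subtuple p B
  have ht : ∑ i ∈ B, addLegendreSym (-1) (p i) = if (∏ i ∈ B, p i) % 4 = 1 then 0 else 1 := by
    rw [← sum_subtuple p B (fun n => addLegendreSym (-1) n), sum_addLegendreSym_neg_one_eq q hqp hq2, hprod]
  rw [ht, qwt_legendre_eq_genusWeight p hp hodd hinj hB]
  by_cases h1 : (∏ i ∈ B, p i) % 4 = 1
  · rw [if_pos h1, if_pos h1, zero_mul, if_neg (by omega)]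
  · rw [if_neg h1, if_neg h1, one_mul]

end PointedBlock

end Literature.NumberTheory.EllipticCurves.Smith2016
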